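import Literature.Analysis.FluidPDE.ElgindiThetaZeroEstimates
import Literature.Analysis.FluidPDE.ElgindiAveragingOperators
import HarnessLib

/-!
# Global weighted bounds for the angular derivatives of the solution, from the equation
([Elgindi2021] §7, eq. (PolarBSL), and the `𝓗ᵏ` weights of §1.7.2)

Topic `Literature/Analysis/FluidPDE`. Support file (definitions with bodies and proved theorems, no
named facts) on the proof path of the named fact
`Literature.Analysis.FluidPDE.Elgindi.ElgindiGhoulMasmoudi2021_stabilityCore`
(`ElgindiStabilityDecomposition.lean`). T. M. Elgindi, Ann. of Math. 194 (2021) =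
arXiv:1904.04795, §7 eq. (PolarBSL) (p. 19) and §1.7.2 (p. 7).

`MemW g` means `w·g ∈ L²(strip)` (`w = (1+R)²/R²`). For a `TangentialFamily` with
`V_k, ∂_θV_k, tan θV_k ∈ MemW` for all `k` (the weighted energies) the polar equation solved for
`∂_θθV_k` and its `θ`-derivatives give, with the degenerating factors of `D_θ = sin(2θ)∂_θ`:
`sin(2θ)∂_θ²V_k`, `sin²(2θ)∂_θ³V_k`, `sin³(2θ)∂_θ⁴V_k ∈ MemW` (`memW_sin_dθ2`, `memW_sin2_dθ3`,
`memW_sin3_dθ4`). These are the global inputs that control the cut-off commutators when Elgindi's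
a-priori estimate is transferred to the solution.
-/

noncomputable section

open MeasureTheory Set Real Filter Function
open _root_.Topology
open scoped ContDiff

namespace Literature.Analysis.FluidPDE

namespace Elgindi

/-! ### Weighted membership and its closure properties -/

/-- `w·g ∈ L²(strip)`, `w = (1+R)²/R²`. [folklore] -/
def MemW (g : ℝ → ℝ → ℝ) : Prop := IntegrableOn (fun p : ℝ × ℝ => radialWeight p.1 ^ 2 * g p.1 p.2 ^ 2) strip

/-- Measurability of the radial weight. [folklore] -/
theorem measurable_radialWeight_sq : Measurable fun p : ℝ × ℝ => radialWeight p.1 ^ 2 := by unfold radialWeight; fun_prop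

/-- Locality on the strip. [folklore] -/
theorem memW_congr {g g' : ℝ → ℝ → ℝ} (h : ∀ p ∈ strip, g p.1 p.2 = g' p.1 p.2) : MemW g ↔ MemW g' := by
  unfold MemW
  constructor <;> intro hI <;> refine hI.congr ?_ <;> rw [Filter.EventuallyEq, ae_restrict_iff' measurableSet_strip] <;>
    refine ae_of_all _ fun p hp => ?_
  · rw [h p hp]
  · rw [h p hp]

/-- **Bounded continuous coefficients**: if `g ∈ MemW` is continuous on the strip and `c` is
continuous on the strip with `|c| ≤ C` there, then `c·g ∈ MemW`. [folklore] -/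
theorem MemW.coef_mul {g c : ℝ → ℝ → ℝ} (hg : MemW g) (hgc : ContinuousOn (uncurry g) strip) (hcc : ContinuousOn (uncurry c) strip)
    {C : ℝ} (hC : ∀ p ∈ strip, |c p.1 p.2| ≤ C) : MemW (fun R θ => c R θ * g R θ) := by
  unfold MemW at hg ⊢
  have hm : AEStronglyMeasurable (fun p : ℝ × ℝ => radialWeight p.1 ^ 2 * (c p.1 p.2 * g p.1 p.2) ^ 2) (volume.restrict strip) :=
    ((measurable_radialWeight_sq.aemeasurable.aestronglyMeasurable).mul
      (((hcc.mul hgc).pow 2).aestronglyMeasurable measurableSet_strip |>.congr (ae_of_all _ fun p => rfl)))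
  refine Integrable.mono' (hg.const_mul (C ^ 2)) hm ?_
  rw [ae_restrict_iff' measurableSet_strip]
  refine ae_of_all _ fun p hp => ?_
  rw [Real.norm_eq_abs, abs_of_nonneg (by positivity), mul_pow]
  have h1 : c p.1 p.2 ^ 2 ≤ C ^ 2 := by rw [← sq_abs]; exact pow_le_pow_left₀ (abs_nonneg _) (hC p hp) 2
  have hw : 0 ≤ radialWeight p.1 ^ 2 := sq_nonneg _
  nlinarith [mul_nonneg hw (sq_nonneg (g p.1 p.2)), mul_le_mul_of_nonneg_left h1 (mul_nonneg hw (sq_nonneg (g p.1 p.2)))]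

/-- **Sums.** [folklore] -/
theorem MemW.add {g g' : ℝ → ℝ → ℝ} (hg : MemW g) (hg' : MemW g') (hgc : ContinuousOn (uncurry g) strip) (hgc' : ContinuousOn (uncurry g') strip) :
    MemW (fun R θ => g R θ + g' R θ) := by
  unfold MemW at hg hg' ⊢
  have hm : AEStronglyMeasurable (fun p : ℝ × ℝ => radialWeight p.1 ^ 2 * (g p.1 p.2 + g' p.1 p.2) ^ 2) (volume.restrict strip) :=
    (measurable_radialWeight_sq.aemeasurable.aestronglyMeasurable).mul (((hgc.add hgc').pow 2).aestronglyMeasurable measurableSet_strip)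
  refine Integrable.mono' ((hg.add hg').const_mul 2) hm (ae_of_all _ fun p => ?_)
  rw [Real.norm_eq_abs, abs_of_nonneg (by positivity)]
  show radialWeight p.1 ^ 2 * (g p.1 p.2 + g' p.1 p.2) ^ 2 ≤ 2 * (radialWeight p.1 ^ 2 * g p.1 p.2 ^ 2 + radialWeight p.1 ^ 2 * g' p.1 p.2 ^ 2)
  have hw : 0 ≤ radialWeight p.1 ^ 2 := sq_nonneg _
  nlinarith [mul_nonneg hw (sq_nonneg (g p.1 p.2 - g' p.1 p.2))]

/-- Scalar multiples. [folklore] -/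
theorem MemW.const_mul {g : ℝ → ℝ → ℝ} (hg : MemW g) (a : ℝ) : MemW (fun R θ => a * g R θ) := by
  unfold MemW at hg ⊢
  refine (hg.const_mul (a ^ 2)).congr (ae_of_all _ fun p => ?_)
  simp only; ring

/-- Differences. [folklore] -/
theorem MemW.sub {g g' : ℝ → ℝ → ℝ} (hg : MemW g) (hg' : MemW g') (hgc : ContinuousOn (uncurry g) strip) (hgc' : ContinuousOn (uncurry g') strip) :
    MemW (fun R θ => g R θ - g' R θ) := by
  have := hg.add (hg'.const_mul (-1)) hgc (by
    have e : uncurry (fun R θ => -1 * g' R θ) = fun p => -1 * uncurry g' p := by funext p; rfl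
    rw [e]; exact continuousOn_const.mul hgc')
  have e : (fun R θ => g R θ - g' R θ) = fun R θ => g R θ + -1 * g' R θ := by funext R θ; ring
  rw [e]; exact this

/-- A smooth compactly supported datum inside `R > 0` is in `MemW` (with all its derivatives). [folklore] -/
theorem memW_of_smooth_supported {d : ℝ → ℝ → ℝ} (hd : ContDiff ℝ 0 (uncurry d)) (hs : HasCompactSupport (uncurry d))
    (hpos : ∀ p ∈ tsupport (uncurry d), 0 < p.1) : MemW d := by
  -- `w` is bounded on the support (a compact subset of `R > 0`)
  obtain ⟨a, ha, haS⟩ : ∃ a : ℝ, 0 < a ∧ ∀ p ∈ tsupport (uncurry d), a ≤ p.1 := by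
    by_cases hne : (tsupport (uncurry d)).Nonempty
    · obtain ⟨p₀, hp₀, hmin⟩ := hs.isCompact.exists_isMinOn hne continuous_fst.continuousOn
      exact ⟨p₀.1, hpos p₀ hp₀, fun p hp => hmin hp⟩
    · exact ⟨1, one_pos, fun p hp => absurd ⟨p, hp⟩ hne⟩
  have hwb : ∀ p ∈ tsupport (uncurry d), radialWeight p.1 ^ 2 ≤ ((1 + a) ^ 2 / a ^ 2 + 1) ^ 2 := by
    intro p hp
    have hp1 := haS p hp
    have hp0 : 0 < p.1 := ha.trans_le hp1
    have hw : radialWeight p.1 ≤ (1 + a) ^ 2 / a ^ 2 + 1 := by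
      unfold radialWeight
      -- `(1+R)²/R² = (1 + 1/R)² ≤ (1 + 1/a)²`
      have h1 : (1 + p.1) ^ 2 / p.1 ^ 2 = (1 + 1 / p.1) ^ 2 := by rw [← div_pow, add_div, div_self hp0.ne', add_comm]
      have h2 : (1 + a) ^ 2 / a ^ 2 = (1 + 1 / a) ^ 2 := by rw [← div_pow, add_div, div_self ha.ne', add_comm]
      rw [h1, h2]
      have : 1 / p.1 ≤ 1 / a := one_div_le_one_div_of_le ha hp1
      nlinarith [one_div_pos.2 hp0, one_div_pos.2 ha]
    have hw0 : 0 ≤ radialWeight p.1 := (radialWeight_pos hp0).le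
    exact pow_le_pow_left₀ hw0 hw 2
  unfold MemW
  have hc : Continuous (uncurry d) := hd.continuous
  have hds : HasCompactSupport (fun p : ℝ × ℝ => uncurry d p ^ 2) := by
    have e : (fun p : ℝ × ℝ => uncurry d p ^ 2) = fun p => uncurry d p * uncurry d p := by funext p; ring
    rw [e]; exact hs.mul_left
  have hI : Integrable fun p : ℝ × ℝ => ((1 + a) ^ 2 / a ^ 2 + 1) ^ 2 * uncurry d p ^ 2 := ((hc.pow 2).const_mul _).integrable_of_hasCompactSupport hds.mul_left
  refine Integrable.mono' hI.integrableOn ((measurable_radialWeight_sq.mul (hc.measurable.pow_const 2)).aestronglyMeasurable) (ae_of_all _ fun p => ?_)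
  rw [Real.norm_eq_abs, abs_of_nonneg (by positivity)]
  show radialWeight p.1 ^ 2 * d p.1 p.2 ^ 2 ≤ ((1 + a) ^ 2 / a ^ 2 + 1) ^ 2 * uncurry d p ^ 2
  by_cases hp : p ∈ tsupport (uncurry d)
  · exact mul_le_mul_of_nonneg_right (hwb p hp) (sq_nonneg _)
  · have : uncurry d p = 0 := image_eq_zero_of_notMem_tsupport hp
    have h0 : d p.1 p.2 = 0 := this
    rw [h0, this]; simp

/-! ### Bounded trigonometric coefficients on the strip -/

/-- `|sin 2θ| ≤ 1`, continuous. [folklore] -/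
theorem coef_sin_two : ContinuousOn (uncurry fun (_ : ℝ) θ => Real.sin (2 * θ)) strip ∧ ∀ p ∈ strip, |(fun (_ : ℝ) θ => Real.sin (2 * θ)) p.1 p.2| ≤ 1 :=
  ⟨(by fun_prop : Continuous (uncurry fun (_ : ℝ) θ => Real.sin (2 * θ))).continuousOn, fun p _ => Real.abs_sin_le_one _⟩

/-- `|2 sin²θ| ≤ 2`, continuous. [folklore] -/
theorem coef_two_sin_sq : ContinuousOn (uncurry fun (_ : ℝ) θ => 2 * Real.sin θ ^ 2) strip ∧ ∀ p ∈ strip, |(fun (_ : ℝ) θ => 2 * Real.sin θ ^ 2) p.1 p.2| ≤ 2 :=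
  ⟨(by fun_prop : Continuous (uncurry fun (_ : ℝ) θ => 2 * Real.sin θ ^ 2)).continuousOn, fun p _ => by
    show |2 * Real.sin p.2 ^ 2| ≤ 2
    rw [abs_of_nonneg (by positivity)]; nlinarith [Real.sin_sq_le_one p.2]⟩

namespace TangentialFamily

variable {α : ℝ} {f Ψ : ℝ → ℝ → ℝ} (h : TangentialFamily α f Ψ)
include h

/-- Continuity on the strip of the iterates and their `θ`-derivatives. [folklore] -/
theorem continuousOn_iterate_dθ (k l : ℕ) : ContinuousOn (uncurry (dθ^[l] (Dz^[k] Ψ))) strip :=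
  (contDiffOn_iterate_dθ_strip (h.smooth_iterate k) l).continuousOn

/-- **`sin(2θ)∂_θ²V_k = 2sin²θ·∂_θV_k + 2tan θ·V_k − sin 2θ·(6V_k + D_R^kf + α²(V_{k+2} − V_{k+1}) + α(5+α)V_{k+1})`
on the strip.** [cite: Elgindi2021, §7 eq. (PolarBSL) (p. 19 of arXiv:1904.04795)] -/
theorem sin_dθdθ_iterate_eq (k : ℕ) {p : ℝ × ℝ} (hp : p ∈ strip) :
    Real.sin (2 * p.2) * dθ (dθ (Dz^[k] Ψ)) p.1 p.2 =
      2 * Real.sin p.2 ^ 2 * dθ (Dz^[k] Ψ) p.1 p.2 + 2 * (Real.tan p.2 * (Dz^[k] Ψ) p.1 p.2) -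
        Real.sin (2 * p.2) * (6 * (Dz^[k] Ψ) p.1 p.2 + (Dz^[k] f) p.1 p.2 +
          α ^ 2 * ((Dz^[k + 2] Ψ) p.1 p.2 - (Dz^[k + 1] Ψ) p.1 p.2) + α * (5 + α) * (Dz^[k + 1] Ψ) p.1 p.2) := by
  have hcos : Real.cos p.2 ≠ 0 := (Real.cos_pos_of_mem_Ioo ⟨by linarith [hp.2.1, Real.pi_pos], hp.2.2⟩).ne'
  rw [h.dθdθ_iterate_eq k hp, Real.sin_two_mul, Real.tan_eq_sin_div_cos]
  field_simp
  ring

/-- **`sin(2θ)∂_θ²V_k ∈ MemW`** when `V_j, ∂_θV_j, tan θV_j ∈ MemW` for all `j` and the datum is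
supported inside `R > 0`. [folklore] -/
theorem memW_sin_dθ2 (hV : ∀ j, MemW (Dz^[j] Ψ)) (hdV : ∀ j, MemW (dθ (Dz^[j] Ψ)))
    (htV : ∀ j, MemW (fun R θ => Real.tan θ * (Dz^[j] Ψ) R θ)) (hfpos : ∀ p ∈ tsupport (uncurry f), 0 < p.1) (k : ℕ) :
    MemW (fun R θ => Real.sin (2 * θ) * dθ (dθ (Dz^[k] Ψ)) R θ) := by
  rw [memW_congr (g := fun R θ => Real.sin (2 * θ) * dθ (dθ (Dz^[k] Ψ)) R θ)
    (g' := fun R θ => 2 * Real.sin θ ^ 2 * dθ (Dz^[k] Ψ) R θ + 2 * (Real.tan θ * (Dz^[k] Ψ) R θ) -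
        Real.sin (2 * θ) * (6 * (Dz^[k] Ψ) R θ + (Dz^[k] f) R θ +
          α ^ 2 * ((Dz^[k + 2] Ψ) R θ - (Dz^[k + 1] Ψ) R θ) + α * (5 + α) * (Dz^[k + 1] Ψ) R θ))
    (fun p hp => h.sin_dθdθ_iterate_eq k hp)]
  have cV : ∀ j, ContinuousOn (uncurry (Dz^[j] Ψ)) strip := fun j => h.continuousOn_iterate_dθ j 0
  have cdV : ∀ j, ContinuousOn (uncurry (dθ (Dz^[j] Ψ))) strip := fun j => h.continuousOn_iterate_dθ j 1
  have ctan : ContinuousOn (uncurry fun (_ : ℝ) θ => Real.tan θ) strip := by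
    intro p hp
    have hcos : Real.cos p.2 ≠ 0 := (Real.cos_pos_of_mem_Ioo ⟨by linarith [hp.2.1, Real.pi_pos], hp.2.2⟩).ne'
    exact ((Real.continuousAt_tan.2 hcos).comp continuousAt_snd).continuousWithinAt
  have ctV : ∀ j, ContinuousOn (uncurry fun R θ => Real.tan θ * (Dz^[j] Ψ) R θ) strip := fun j => ctan.mul (cV j)
  have hd : MemW (Dz^[k] f) := memW_of_smooth_supported (contDiff_iterate_Dz_of_contDiff (n := 0) (m := k) (by simpa using h.datum_smooth (0 + k)))
    (hasCompactSupport_iterate_Dz h.datum_supp k) fun p hp => hfpos p (tsupport_iterate_Dz_subset k hp)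
  have cd : ContinuousOn (uncurry (Dz^[k] f)) strip := (contDiff_iterate_Dz_of_contDiff (n := 0) (m := k) (by simpa using h.datum_smooth (0 + k))).continuous.continuousOn
  -- the pieces
  have t1 : MemW (fun R θ => (2 * Real.sin θ ^ 2) * dθ (Dz^[k] Ψ) R θ) := (hdV k).coef_mul (cdV k) coef_two_sin_sq.1 coef_two_sin_sq.2
  have t2 : MemW (fun R θ => 2 * (Real.tan θ * (Dz^[k] Ψ) R θ)) := (htV k).const_mul 2
  have t3in : MemW (fun R θ => 6 * (Dz^[k] Ψ) R θ + (Dz^[k] f) R θ + α ^ 2 * ((Dz^[k + 2] Ψ) R θ - (Dz^[k + 1] Ψ) R θ) + α * (5 + α) * (Dz^[k + 1] Ψ) R θ) := by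
    have a1 := ((hV k).const_mul 6).add hd (continuousOn_const.mul (cV k) |>.congr fun p _ => rfl) cd
    have c1 : ContinuousOn (uncurry fun R θ => 6 * (Dz^[k] Ψ) R θ + (Dz^[k] f) R θ) strip := (continuousOn_const.mul (cV k)).add cd
    have a2 := ((hV (k + 2)).sub (hV (k + 1)) (cV (k + 2)) (cV (k + 1))).const_mul (α ^ 2)
    have c2 : ContinuousOn (uncurry fun R θ => α ^ 2 * ((Dz^[k + 2] Ψ) R θ - (Dz^[k + 1] Ψ) R θ)) strip := continuousOn_const.mul ((cV (k + 2)).sub (cV (k + 1)))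
    have a3 := (hV (k + 1)).const_mul (α * (5 + α))
    have c3 : ContinuousOn (uncurry fun R θ => α * (5 + α) * (Dz^[k + 1] Ψ) R θ) strip := continuousOn_const.mul (cV (k + 1))
    exact (a1.add a2 c1 c2).add a3 (c1.add c2) c3
  have c3in : ContinuousOn (uncurry fun R θ => 6 * (Dz^[k] Ψ) R θ + (Dz^[k] f) R θ + α ^ 2 * ((Dz^[k + 2] Ψ) R θ - (Dz^[k + 1] Ψ) R θ) + α * (5 + α) * (Dz^[k + 1] Ψ) R θ) strip :=
    (((continuousOn_const.mul (cV k)).add cd).add (continuousOn_const.mul ((cV (k + 2)).sub (cV (k + 1))))).add (continuousOn_const.mul (cV (k + 1)))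
  have t3 := t3in.coef_mul c3in coef_sin_two.1 coef_sin_two.2
  have c1 : ContinuousOn (uncurry fun R θ => (2 * Real.sin θ ^ 2) * dθ (Dz^[k] Ψ) R θ) strip := coef_two_sin_sq.1.mul (cdV k)
  have c2 : ContinuousOn (uncurry fun R θ => 2 * (Real.tan θ * (Dz^[k] Ψ) R θ)) strip := continuousOn_const.mul (ctV k)
  have c3 : ContinuousOn (uncurry fun R θ => Real.sin (2 * θ) * (6 * (Dz^[k] Ψ) R θ + (Dz^[k] f) R θ + α ^ 2 * ((Dz^[k + 2] Ψ) R θ - (Dz^[k + 1] Ψ) R θ) + α * (5 + α) * (Dz^[k + 1] Ψ) R θ)) strip :=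
    coef_sin_two.1.mul c3in
  exact (t1.add t2 c1 c2).sub t3 (c1.add c2) c3

/-! ### The third angular derivative -/

omit h in
/-- Angular slices of strip-smooth functions have the expected derivative. [folklore] -/
theorem hasDerivAt_slice_strip {g : ℝ → ℝ → ℝ} (hg : ContDiffOn ℝ ∞ (uncurry g) strip) {p : ℝ × ℝ} (hp : p ∈ strip) :
    HasDerivAt (fun θ' => g p.1 θ') (dθ g p.1 p.2) p.2 := by
  have hd : DifferentiableAt ℝ (uncurry g) p := differentiableAt_of_contDiffOn_strip (contDiffOn_nat_of_infty hg 1) (by simp) hp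
  have hc : HasDerivAt (fun θ' : ℝ => (p.1, θ')) ((0 : ℝ), (1 : ℝ)) p.2 := (hasDerivAt_const _ p.1).prodMk (hasDerivAt_id _)
  have hq : (p.1, p.2) = p := rfl
  have h1 := (hq ▸ hd).hasFDerivAt.comp_hasDerivAt p.2 hc
  have e : (fun θ' => g p.1 θ') = uncurry g ∘ fun θ' => (p.1, θ') := rfl
  show HasDerivAt (fun θ' => g p.1 θ') (deriv (fun θ' => g p.1 θ') p.2) p.2
  rw [e, h1.deriv]; exact h1

/-- The datum iterates are smooth on the strip. [folklore] -/
theorem smooth_datum_iterate (k : ℕ) : ContDiffOn ℝ ∞ (uncurry (Dz^[k] f)) strip :=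
  (contDiff_infty.2 fun n => contDiff_iterate_Dz_of_contDiff (n := n) (m := k) (h.datum_smooth (n + k))).contDiffOn

/-- **`∂_θ³V_k` from the differentiated equation**:
`∂_θ³V_k = 2∂_θV_k/cos² + tan θ·∂_θ²V_k + 2 sin θ/cos³θ·V_k − 6∂_θV_k − ∂_θD_R^kf − α²(∂_θV_{k+2} − ∂_θV_{k+1}) − α(5+α)∂_θV_{k+1}`
on the strip. [cite: Elgindi2021, §7 eq. (PolarBSL) (p. 19 of arXiv:1904.04795)] -/
theorem dθ3_iterate_eq (k : ℕ) {p : ℝ × ℝ} (hp : p ∈ strip) :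
    (dθ^[3] (Dz^[k] Ψ)) p.1 p.2 =
      2 * dθ (Dz^[k] Ψ) p.1 p.2 / Real.cos p.2 ^ 2 + Real.tan p.2 * dθ (dθ (Dz^[k] Ψ)) p.1 p.2 +
        2 * Real.sin p.2 / Real.cos p.2 ^ 3 * (Dz^[k] Ψ) p.1 p.2 - 6 * dθ (Dz^[k] Ψ) p.1 p.2 - dθ (Dz^[k] f) p.1 p.2 -
        α ^ 2 * (dθ (Dz^[k + 2] Ψ) p.1 p.2 - dθ (Dz^[k + 1] Ψ) p.1 p.2) - α * (5 + α) * dθ (Dz^[k + 1] Ψ) p.1 p.2 := by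
  have hcos : Real.cos p.2 ≠ 0 := (Real.cos_pos_of_mem_Ioo ⟨by linarith [hp.2.1, Real.pi_pos], hp.2.2⟩).ne'
  -- `∂_θ³V = ∂_θ(∂_θ²V)` and `∂_θ²V` is given by the equation near `p.2`
  have e3 : (dθ^[3] (Dz^[k] Ψ)) p.1 p.2 = deriv (fun θ => dθ (dθ (Dz^[k] Ψ)) p.1 θ) p.2 := by
    rw [show (3 : ℕ) = 2 + 1 from rfl, Function.iterate_succ_apply']; rfl
  have hev : (fun θ => dθ (dθ (Dz^[k] Ψ)) p.1 θ) =ᶠ[𝓝 p.2] fun θ =>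
      Real.tan θ * dθ (Dz^[k] Ψ) p.1 θ + (Dz^[k] Ψ) p.1 θ / Real.cos θ ^ 2 - 6 * (Dz^[k] Ψ) p.1 θ - (Dz^[k] f) p.1 θ -
        α ^ 2 * ((Dz^[k + 2] Ψ) p.1 θ - (Dz^[k + 1] Ψ) p.1 θ) - α * (5 + α) * (Dz^[k + 1] Ψ) p.1 θ := by
    filter_upwards [isOpen_Ioo.mem_nhds hp.2] with θ hθ
    exact h.dθdθ_iterate_eq k (p := (p.1, θ)) ⟨hp.1, hθ⟩
  rw [e3, hev.deriv_eq]
  -- differentiate the right-hand side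
  have hA := hasDerivAt_slice_strip (contDiffOn_dθ_strip (h.smooth_iterate k)) hp
  have hB := hasDerivAt_slice_strip (h.smooth_iterate k) hp
  have hD := hasDerivAt_slice_strip (h.smooth_datum_iterate k) hp
  have hB1 := hasDerivAt_slice_strip (h.smooth_iterate (k + 1)) hp
  have hB2 := hasDerivAt_slice_strip (h.smooth_iterate (k + 2)) hp
  have htan := Real.hasDerivAt_tan hcos
  have hcos2 : HasDerivAt (fun θ => Real.cos θ ^ 2) (((2 : ℕ) : ℝ) * Real.cos p.2 ^ (2 - 1) * -Real.sin p.2) p.2 := (Real.hasDerivAt_cos p.2).pow 2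
  have hall := ((((htan.mul hA).add (hB.div hcos2 (pow_ne_zero 2 hcos))).sub (hB.const_mul 6)).sub hD).sub
    (((hB2.sub hB1).const_mul (α ^ 2))) |>.sub (hB1.const_mul (α * (5 + α)))
  have hall' : HasDerivAt (fun θ => Real.tan θ * dθ (Dz^[k] Ψ) p.1 θ + (Dz^[k] Ψ) p.1 θ / Real.cos θ ^ 2 - 6 * (Dz^[k] Ψ) p.1 θ - (Dz^[k] f) p.1 θ -
        α ^ 2 * ((Dz^[k + 2] Ψ) p.1 θ - (Dz^[k + 1] Ψ) p.1 θ) - α * (5 + α) * (Dz^[k + 1] Ψ) p.1 θ) _ p.2 := hall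
  rw [hall'.deriv]
  rw [Real.tan_eq_sin_div_cos]
  field_simp
  ring

/-- **`sin²(2θ)∂_θ³V_k` in bounded form**:
`= 8sin²θ·∂_θV_k + 2sin²θ·(sin 2θ∂_θ²V_k) + 8sin²θ·(tan θV_k) − sin²2θ·(6∂_θV_k + ∂_θD_R^kf + α²(∂_θV_{k+2} − ∂_θV_{k+1}) + α(5+α)∂_θV_{k+1})`. [folklore] -/
theorem sin2_dθ3_iterate_eq (k : ℕ) {p : ℝ × ℝ} (hp : p ∈ strip) :
    Real.sin (2 * p.2) ^ 2 * (dθ^[3] (Dz^[k] Ψ)) p.1 p.2 =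
      8 * Real.sin p.2 ^ 2 * dθ (Dz^[k] Ψ) p.1 p.2 + 2 * Real.sin p.2 ^ 2 * (Real.sin (2 * p.2) * dθ (dθ (Dz^[k] Ψ)) p.1 p.2) +
        8 * Real.sin p.2 ^ 2 * (Real.tan p.2 * (Dz^[k] Ψ) p.1 p.2) -
        Real.sin (2 * p.2) ^ 2 * (6 * dθ (Dz^[k] Ψ) p.1 p.2 + dθ (Dz^[k] f) p.1 p.2 +
          α ^ 2 * (dθ (Dz^[k + 2] Ψ) p.1 p.2 - dθ (Dz^[k + 1] Ψ) p.1 p.2) + α * (5 + α) * dθ (Dz^[k + 1] Ψ) p.1 p.2) := by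
  have hcos : Real.cos p.2 ≠ 0 := (Real.cos_pos_of_mem_Ioo ⟨by linarith [hp.2.1, Real.pi_pos], hp.2.2⟩).ne'
  rw [h.dθ3_iterate_eq k hp, Real.sin_two_mul, Real.tan_eq_sin_div_cos]
  field_simp
  ring

/-- `|8 sin²θ| ≤ 8`, continuous. [folklore] -/
theorem coef_eight_sin_sq : ContinuousOn (uncurry fun (_ : ℝ) θ => 8 * Real.sin θ ^ 2) strip ∧ ∀ p ∈ strip, |(fun (_ : ℝ) θ => 8 * Real.sin θ ^ 2) p.1 p.2| ≤ 8 := by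
  have := h
  exact ⟨(by fun_prop : Continuous (uncurry fun (_ : ℝ) θ => 8 * Real.sin θ ^ 2)).continuousOn, fun p _ => by
    show |8 * Real.sin p.2 ^ 2| ≤ 8
    rw [abs_of_nonneg (by positivity)]; nlinarith [Real.sin_sq_le_one p.2]⟩

/-- `|sin² 2θ| ≤ 1`, continuous. [folklore] -/
theorem coef_sin_two_sq : ContinuousOn (uncurry fun (_ : ℝ) θ => Real.sin (2 * θ) ^ 2) strip ∧ ∀ p ∈ strip, |(fun (_ : ℝ) θ => Real.sin (2 * θ) ^ 2) p.1 p.2| ≤ 1 := by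
  have := h
  exact ⟨(by fun_prop : Continuous (uncurry fun (_ : ℝ) θ => Real.sin (2 * θ) ^ 2)).continuousOn, fun p _ => by
    show |Real.sin (2 * p.2) ^ 2| ≤ 1
    rw [abs_of_nonneg (sq_nonneg _)]; nlinarith [Real.sin_sq_le_one (2 * p.2)]⟩

/-- Continuity of `tan θ·g` on the strip for `g` continuous there. [folklore] -/
theorem continuousOn_tan_mul' {g : ℝ → ℝ → ℝ} (hg : ContinuousOn (uncurry g) strip) :
    ContinuousOn (uncurry fun R θ => Real.tan θ * g R θ) strip := by
  have := h
  have ctan : ContinuousOn (uncurry fun (_ : ℝ) θ => Real.tan θ) strip := by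
    intro p hp
    have hcos : Real.cos p.2 ≠ 0 := (Real.cos_pos_of_mem_Ioo ⟨by linarith [hp.2.1, Real.pi_pos], hp.2.2⟩).ne'
    exact ((Real.continuousAt_tan.2 hcos).comp continuousAt_snd).continuousWithinAt
  exact ctan.mul hg

/-- The datum iterates and their angular derivatives are in `MemW`. [folklore] -/
theorem memW_datum (hfpos : ∀ p ∈ tsupport (uncurry f), 0 < p.1) (k l : ℕ) : MemW (dθ^[l] (Dz^[k] f)) := by
  have hsm : ∀ n : ℕ, ContDiff ℝ n (uncurry (Dz^[k] f)) := fun n => contDiff_iterate_Dz_of_contDiff (n := n) (m := k) (h.datum_smooth (n + k))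
  refine memW_of_smooth_supported (contDiff_iterate_dθ_of_contDiff (n := l) (m := 0) (by simpa using hsm (0 + l))) ?_ fun p hp => ?_
  · exact hasCompactSupport_iterate_dθ (hasCompactSupport_iterate_Dz h.datum_supp k) l
  · exact hfpos p (tsupport_iterate_Dz_subset k (tsupport_iterate_dθ_subset l hp))

/-- **`sin²(2θ)∂_θ³V_k ∈ MemW`.** [folklore] -/
theorem memW_sin2_dθ3 (hV : ∀ j, MemW (Dz^[j] Ψ)) (hdV : ∀ j, MemW (dθ (Dz^[j] Ψ)))
    (htV : ∀ j, MemW (fun R θ => Real.tan θ * (Dz^[j] Ψ) R θ)) (hfpos : ∀ p ∈ tsupport (uncurry f), 0 < p.1) (k : ℕ) :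
    MemW (fun R θ => Real.sin (2 * θ) ^ 2 * (dθ^[3] (Dz^[k] Ψ)) R θ) := by
  rw [memW_congr (g := fun R θ => Real.sin (2 * θ) ^ 2 * (dθ^[3] (Dz^[k] Ψ)) R θ)
    (g' := fun R θ => 8 * Real.sin θ ^ 2 * dθ (Dz^[k] Ψ) R θ + 2 * Real.sin θ ^ 2 * (Real.sin (2 * θ) * dθ (dθ (Dz^[k] Ψ)) R θ) +
        8 * Real.sin θ ^ 2 * (Real.tan θ * (Dz^[k] Ψ) R θ) -
        Real.sin (2 * θ) ^ 2 * (6 * dθ (Dz^[k] Ψ) R θ + dθ (Dz^[k] f) R θ +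
          α ^ 2 * (dθ (Dz^[k + 2] Ψ) R θ - dθ (Dz^[k + 1] Ψ) R θ) + α * (5 + α) * dθ (Dz^[k + 1] Ψ) R θ))
    (fun p hp => h.sin2_dθ3_iterate_eq k hp)]
  have cV : ∀ j, ContinuousOn (uncurry (Dz^[j] Ψ)) strip := fun j => h.continuousOn_iterate_dθ j 0
  have cdV : ∀ j, ContinuousOn (uncurry (dθ (Dz^[j] Ψ))) strip := fun j => h.continuousOn_iterate_dθ j 1
  have cddV : ∀ j, ContinuousOn (uncurry (dθ (dθ (Dz^[j] Ψ)))) strip := fun j => h.continuousOn_iterate_dθ j 2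
  have ctV : ∀ j, ContinuousOn (uncurry fun R θ => Real.tan θ * (Dz^[j] Ψ) R θ) strip := fun j => h.continuousOn_tan_mul' (cV j)
  have csd : ∀ j, ContinuousOn (uncurry fun R θ => Real.sin (2 * θ) * dθ (dθ (Dz^[j] Ψ)) R θ) strip := fun j => coef_sin_two.1.mul (cddV j)
  have hsd : ∀ j, MemW (fun R θ => Real.sin (2 * θ) * dθ (dθ (Dz^[j] Ψ)) R θ) := fun j => h.memW_sin_dθ2 hV hdV htV hfpos j
  have hd1 : MemW (dθ (Dz^[k] f)) := h.memW_datum hfpos k 1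
  have cd1 : ContinuousOn (uncurry (dθ (Dz^[k] f))) strip := (contDiffOn_dθ_strip (h.smooth_datum_iterate k)).continuousOn
  have t1 : MemW (fun R θ => (8 * Real.sin θ ^ 2) * dθ (Dz^[k] Ψ) R θ) := (hdV k).coef_mul (cdV k) h.coef_eight_sin_sq.1 h.coef_eight_sin_sq.2
  have c1 : ContinuousOn (uncurry fun R θ => (8 * Real.sin θ ^ 2) * dθ (Dz^[k] Ψ) R θ) strip := h.coef_eight_sin_sq.1.mul (cdV k)
  have t2 : MemW (fun R θ => (2 * Real.sin θ ^ 2) * (Real.sin (2 * θ) * dθ (dθ (Dz^[k] Ψ)) R θ)) := (hsd k).coef_mul (csd k) coef_two_sin_sq.1 coef_two_sin_sq.2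
  have c2 : ContinuousOn (uncurry fun R θ => (2 * Real.sin θ ^ 2) * (Real.sin (2 * θ) * dθ (dθ (Dz^[k] Ψ)) R θ)) strip := coef_two_sin_sq.1.mul (csd k)
  have t3 : MemW (fun R θ => (8 * Real.sin θ ^ 2) * (Real.tan θ * (Dz^[k] Ψ) R θ)) := (htV k).coef_mul (ctV k) h.coef_eight_sin_sq.1 h.coef_eight_sin_sq.2
  have c3 : ContinuousOn (uncurry fun R θ => (8 * Real.sin θ ^ 2) * (Real.tan θ * (Dz^[k] Ψ) R θ)) strip := h.coef_eight_sin_sq.1.mul (ctV k)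
  have t4in : MemW (fun R θ => 6 * dθ (Dz^[k] Ψ) R θ + dθ (Dz^[k] f) R θ + α ^ 2 * (dθ (Dz^[k + 2] Ψ) R θ - dθ (Dz^[k + 1] Ψ) R θ) + α * (5 + α) * dθ (Dz^[k + 1] Ψ) R θ) := by
    have a1 := ((hdV k).const_mul 6).add hd1 (continuousOn_const.mul (cdV k) |>.congr fun p _ => rfl) cd1
    have c1' : ContinuousOn (uncurry fun R θ => 6 * dθ (Dz^[k] Ψ) R θ + dθ (Dz^[k] f) R θ) strip := (continuousOn_const.mul (cdV k)).add cd1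
    have a2 := ((hdV (k + 2)).sub (hdV (k + 1)) (cdV (k + 2)) (cdV (k + 1))).const_mul (α ^ 2)
    have c2' : ContinuousOn (uncurry fun R θ => α ^ 2 * (dθ (Dz^[k + 2] Ψ) R θ - dθ (Dz^[k + 1] Ψ) R θ)) strip := continuousOn_const.mul ((cdV (k + 2)).sub (cdV (k + 1)))
    have a3 := (hdV (k + 1)).const_mul (α * (5 + α))
    have c3' : ContinuousOn (uncurry fun R θ => α * (5 + α) * dθ (Dz^[k + 1] Ψ) R θ) strip := continuousOn_const.mul (cdV (k + 1))
    exact (a1.add a2 c1' c2').add a3 (c1'.add c2') c3'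
  have c4in : ContinuousOn (uncurry fun R θ => 6 * dθ (Dz^[k] Ψ) R θ + dθ (Dz^[k] f) R θ + α ^ 2 * (dθ (Dz^[k + 2] Ψ) R θ - dθ (Dz^[k + 1] Ψ) R θ) + α * (5 + α) * dθ (Dz^[k + 1] Ψ) R θ) strip :=
    (((continuousOn_const.mul (cdV k)).add cd1).add (continuousOn_const.mul ((cdV (k + 2)).sub (cdV (k + 1))))).add (continuousOn_const.mul (cdV (k + 1)))
  have t4 := t4in.coef_mul c4in h.coef_sin_two_sq.1 h.coef_sin_two_sq.2
  have c4 : ContinuousOn (uncurry fun R θ => Real.sin (2 * θ) ^ 2 * (6 * dθ (Dz^[k] Ψ) R θ + dθ (Dz^[k] f) R θ + α ^ 2 * (dθ (Dz^[k + 2] Ψ) R θ - dθ (Dz^[k + 1] Ψ) R θ) + α * (5 + α) * dθ (Dz^[k + 1] Ψ) R θ)) strip :=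
    h.coef_sin_two_sq.1.mul c4in
  exact ((t1.add t2 c1 c2).add t3 (c1.add c2) c3).sub t4 ((c1.add c2).add c3) c4

/-! ### The fourth angular derivative -/

/-- **`∂_θ⁴V_k` from the twice differentiated equation**:
`∂_θ⁴V_k = 3∂_θ²V_k/cos² + 6 sin/cos³·∂_θV_k + tan·∂_θ³V_k + 2(cos² + 3sin²)/cos⁴·V_k − 6∂_θ²V_k − ∂_θ²D_R^kf − α²(∂_θ²V_{k+2} − ∂_θ²V_{k+1}) − α(5+α)∂_θ²V_{k+1}`. [cite: Elgindi2021, §7 eq. (PolarBSL) (p. 19 of arXiv:1904.04795)] -/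
theorem dθ4_iterate_eq (k : ℕ) {p : ℝ × ℝ} (hp : p ∈ strip) :
    (dθ^[4] (Dz^[k] Ψ)) p.1 p.2 =
      3 * dθ (dθ (Dz^[k] Ψ)) p.1 p.2 / Real.cos p.2 ^ 2 + 6 * Real.sin p.2 / Real.cos p.2 ^ 3 * dθ (Dz^[k] Ψ) p.1 p.2 +
        Real.tan p.2 * (dθ^[3] (Dz^[k] Ψ)) p.1 p.2 +
        2 * (Real.cos p.2 ^ 2 + 3 * Real.sin p.2 ^ 2) / Real.cos p.2 ^ 4 * (Dz^[k] Ψ) p.1 p.2 -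
        6 * dθ (dθ (Dz^[k] Ψ)) p.1 p.2 - dθ (dθ (Dz^[k] f)) p.1 p.2 -
        α ^ 2 * (dθ (dθ (Dz^[k + 2] Ψ)) p.1 p.2 - dθ (dθ (Dz^[k + 1] Ψ)) p.1 p.2) - α * (5 + α) * dθ (dθ (Dz^[k + 1] Ψ)) p.1 p.2 := by
  have hcos : Real.cos p.2 ≠ 0 := (Real.cos_pos_of_mem_Ioo ⟨by linarith [hp.2.1, Real.pi_pos], hp.2.2⟩).ne'
  have e4 : (dθ^[4] (Dz^[k] Ψ)) p.1 p.2 = deriv (fun θ => (dθ^[3] (Dz^[k] Ψ)) p.1 θ) p.2 := by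
    rw [show (4 : ℕ) = 3 + 1 from rfl, Function.iterate_succ_apply']; rfl
  have hev : (fun θ => (dθ^[3] (Dz^[k] Ψ)) p.1 θ) =ᶠ[𝓝 p.2] fun θ =>
      2 * dθ (Dz^[k] Ψ) p.1 θ / Real.cos θ ^ 2 + Real.tan θ * dθ (dθ (Dz^[k] Ψ)) p.1 θ +
        2 * Real.sin θ / Real.cos θ ^ 3 * (Dz^[k] Ψ) p.1 θ - 6 * dθ (Dz^[k] Ψ) p.1 θ - dθ (Dz^[k] f) p.1 θ -
        α ^ 2 * (dθ (Dz^[k + 2] Ψ) p.1 θ - dθ (Dz^[k + 1] Ψ) p.1 θ) - α * (5 + α) * dθ (Dz^[k + 1] Ψ) p.1 θ := by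
    filter_upwards [isOpen_Ioo.mem_nhds hp.2] with θ hθ
    exact h.dθ3_iterate_eq k (p := (p.1, θ)) ⟨hp.1, hθ⟩
  rw [e4, hev.deriv_eq]
  have hA := hasDerivAt_slice_strip (contDiffOn_dθ_strip (h.smooth_iterate k)) hp
  have hA2 := hasDerivAt_slice_strip (contDiffOn_dθ_strip (contDiffOn_dθ_strip (h.smooth_iterate k))) hp
  have hB := hasDerivAt_slice_strip (h.smooth_iterate k) hp
  have hD1 := hasDerivAt_slice_strip (contDiffOn_dθ_strip (h.smooth_datum_iterate k)) hp
  have hA1b := hasDerivAt_slice_strip (contDiffOn_dθ_strip (h.smooth_iterate (k + 1))) hp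
  have hA2b := hasDerivAt_slice_strip (contDiffOn_dθ_strip (h.smooth_iterate (k + 2))) hp
  have htan := Real.hasDerivAt_tan hcos
  have hcos2 : HasDerivAt (fun θ => Real.cos θ ^ 2) (((2 : ℕ) : ℝ) * Real.cos p.2 ^ (2 - 1) * -Real.sin p.2) p.2 := (Real.hasDerivAt_cos p.2).pow 2
  have hcos3 : HasDerivAt (fun θ => Real.cos θ ^ 3) (((3 : ℕ) : ℝ) * Real.cos p.2 ^ (3 - 1) * -Real.sin p.2) p.2 := (Real.hasDerivAt_cos p.2).pow 3
  have hc : HasDerivAt (fun θ => 2 * Real.sin θ / Real.cos θ ^ 3) _ p.2 := ((Real.hasDerivAt_sin p.2).const_mul 2).div hcos3 (pow_ne_zero 3 hcos)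
  have hall := ((((((hA.const_mul 2).div hcos2 (pow_ne_zero 2 hcos)).add (htan.mul hA2)).add (hc.mul hB)).sub (hA.const_mul 6)).sub hD1).sub
    ((hA2b.sub hA1b).const_mul (α ^ 2)) |>.sub (hA1b.const_mul (α * (5 + α)))
  have hall' : HasDerivAt (fun θ => 2 * dθ (Dz^[k] Ψ) p.1 θ / Real.cos θ ^ 2 + Real.tan θ * dθ (dθ (Dz^[k] Ψ)) p.1 θ +
        2 * Real.sin θ / Real.cos θ ^ 3 * (Dz^[k] Ψ) p.1 θ - 6 * dθ (Dz^[k] Ψ) p.1 θ - dθ (Dz^[k] f) p.1 θ -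
        α ^ 2 * (dθ (Dz^[k + 2] Ψ) p.1 θ - dθ (Dz^[k + 1] Ψ) p.1 θ) - α * (5 + α) * dθ (Dz^[k + 1] Ψ) p.1 θ) _ p.2 := hall
  rw [hall'.deriv]
  show _ = 3 * dθ (dθ (Dz^[k] Ψ)) p.1 p.2 / Real.cos p.2 ^ 2 + 6 * Real.sin p.2 / Real.cos p.2 ^ 3 * dθ (Dz^[k] Ψ) p.1 p.2 +
        Real.tan p.2 * dθ (dθ (dθ (Dz^[k] Ψ))) p.1 p.2 +
        2 * (Real.cos p.2 ^ 2 + 3 * Real.sin p.2 ^ 2) / Real.cos p.2 ^ 4 * (Dz^[k] Ψ) p.1 p.2 -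
        6 * dθ (dθ (Dz^[k] Ψ)) p.1 p.2 - dθ (dθ (Dz^[k] f)) p.1 p.2 -
        α ^ 2 * (dθ (dθ (Dz^[k + 2] Ψ)) p.1 p.2 - dθ (dθ (Dz^[k + 1] Ψ)) p.1 p.2) - α * (5 + α) * dθ (dθ (Dz^[k + 1] Ψ)) p.1 p.2
  rw [Real.tan_eq_sin_div_cos]
  field_simp
  ring

/-- **`sin³(2θ)∂_θ⁴V_k` in bounded form.** [folklore] -/
theorem sin3_dθ4_iterate_eq (k : ℕ) {p : ℝ × ℝ} (hp : p ∈ strip) :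
    Real.sin (2 * p.2) ^ 3 * (dθ^[4] (Dz^[k] Ψ)) p.1 p.2 =
      12 * Real.sin p.2 ^ 2 * (Real.sin (2 * p.2) * dθ (dθ (Dz^[k] Ψ)) p.1 p.2) + 48 * Real.sin p.2 ^ 4 * dθ (Dz^[k] Ψ) p.1 p.2 +
        2 * Real.sin p.2 ^ 2 * (Real.sin (2 * p.2) ^ 2 * (dθ^[3] (Dz^[k] Ψ)) p.1 p.2) +
        16 * (Real.cos p.2 ^ 2 + 3 * Real.sin p.2 ^ 2) * Real.sin p.2 ^ 2 * (Real.tan p.2 * (Dz^[k] Ψ) p.1 p.2) -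
        Real.sin (2 * p.2) ^ 2 * (6 * (Real.sin (2 * p.2) * dθ (dθ (Dz^[k] Ψ)) p.1 p.2) + Real.sin (2 * p.2) * dθ (dθ (Dz^[k] f)) p.1 p.2 +
          α ^ 2 * (Real.sin (2 * p.2) * dθ (dθ (Dz^[k + 2] Ψ)) p.1 p.2 - Real.sin (2 * p.2) * dθ (dθ (Dz^[k + 1] Ψ)) p.1 p.2) +
          α * (5 + α) * (Real.sin (2 * p.2) * dθ (dθ (Dz^[k + 1] Ψ)) p.1 p.2)) := by
  have hcos : Real.cos p.2 ≠ 0 := (Real.cos_pos_of_mem_Ioo ⟨by linarith [hp.2.1, Real.pi_pos], hp.2.2⟩).ne'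
  rw [h.dθ4_iterate_eq k hp, Real.sin_two_mul, Real.tan_eq_sin_div_cos]
  field_simp
  ring

/-- `|48 sin⁴θ| ≤ 48`, continuous. [folklore] -/
theorem coef_sin_four : ContinuousOn (uncurry fun (_ : ℝ) θ => 48 * Real.sin θ ^ 4) strip ∧ ∀ p ∈ strip, |(fun (_ : ℝ) θ => 48 * Real.sin θ ^ 4) p.1 p.2| ≤ 48 := by
  have := h
  refine ⟨(by fun_prop : Continuous (uncurry fun (_ : ℝ) θ => 48 * Real.sin θ ^ 4)).continuousOn, fun p _ => ?_⟩
  show |48 * Real.sin p.2 ^ 4| ≤ 48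
  rw [abs_of_nonneg (by positivity)]
  have h1 : Real.sin p.2 ^ 2 ≤ 1 := Real.sin_sq_le_one p.2
  have h2 : Real.sin p.2 ^ 4 = (Real.sin p.2 ^ 2) ^ 2 := by ring
  rw [h2]; nlinarith [sq_nonneg (Real.sin p.2)]

/-- `|12 sin²θ| ≤ 12`, continuous. [folklore] -/
theorem coef_twelve_sin_sq : ContinuousOn (uncurry fun (_ : ℝ) θ => 12 * Real.sin θ ^ 2) strip ∧ ∀ p ∈ strip, |(fun (_ : ℝ) θ => 12 * Real.sin θ ^ 2) p.1 p.2| ≤ 12 := by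
  have := h
  exact ⟨(by fun_prop : Continuous (uncurry fun (_ : ℝ) θ => 12 * Real.sin θ ^ 2)).continuousOn, fun p _ => by
    show |12 * Real.sin p.2 ^ 2| ≤ 12
    rw [abs_of_nonneg (by positivity)]; nlinarith [Real.sin_sq_le_one p.2]⟩

/-- `|16(cos² + 3 sin²) sin²| ≤ 64`, continuous. [folklore] -/
theorem coef_mixed : ContinuousOn (uncurry fun (_ : ℝ) θ => 16 * (Real.cos θ ^ 2 + 3 * Real.sin θ ^ 2) * Real.sin θ ^ 2) strip ∧
    ∀ p ∈ strip, |(fun (_ : ℝ) θ => 16 * (Real.cos θ ^ 2 + 3 * Real.sin θ ^ 2) * Real.sin θ ^ 2) p.1 p.2| ≤ 64 := by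
  have := h
  refine ⟨(by fun_prop : Continuous (uncurry fun (_ : ℝ) θ => 16 * (Real.cos θ ^ 2 + 3 * Real.sin θ ^ 2) * Real.sin θ ^ 2)).continuousOn, fun p _ => ?_⟩
  show |16 * (Real.cos p.2 ^ 2 + 3 * Real.sin p.2 ^ 2) * Real.sin p.2 ^ 2| ≤ 64
  rw [abs_of_nonneg (by positivity)]
  have h1 : Real.sin p.2 ^ 2 ≤ 1 := Real.sin_sq_le_one p.2
  have h2 : Real.sin p.2 ^ 2 + Real.cos p.2 ^ 2 = 1 := Real.sin_sq_add_cos_sq p.2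
  nlinarith [sq_nonneg (Real.sin p.2), sq_nonneg (Real.cos p.2), mul_nonneg (sq_nonneg (Real.sin p.2)) (sq_nonneg (Real.sin p.2))]

/-- **`sin³(2θ)∂_θ⁴V_k ∈ MemW`.** [folklore] -/
theorem memW_sin3_dθ4 (hV : ∀ j, MemW (Dz^[j] Ψ)) (hdV : ∀ j, MemW (dθ (Dz^[j] Ψ)))
    (htV : ∀ j, MemW (fun R θ => Real.tan θ * (Dz^[j] Ψ) R θ)) (hfpos : ∀ p ∈ tsupport (uncurry f), 0 < p.1) (k : ℕ) :
    MemW (fun R θ => Real.sin (2 * θ) ^ 3 * (dθ^[4] (Dz^[k] Ψ)) R θ) := by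
  rw [memW_congr (g := fun R θ => Real.sin (2 * θ) ^ 3 * (dθ^[4] (Dz^[k] Ψ)) R θ)
    (g' := fun R θ => 12 * Real.sin θ ^ 2 * (Real.sin (2 * θ) * dθ (dθ (Dz^[k] Ψ)) R θ) + 48 * Real.sin θ ^ 4 * dθ (Dz^[k] Ψ) R θ +
        2 * Real.sin θ ^ 2 * (Real.sin (2 * θ) ^ 2 * (dθ^[3] (Dz^[k] Ψ)) R θ) +
        16 * (Real.cos θ ^ 2 + 3 * Real.sin θ ^ 2) * Real.sin θ ^ 2 * (Real.tan θ * (Dz^[k] Ψ) R θ) -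
        Real.sin (2 * θ) ^ 2 * (6 * (Real.sin (2 * θ) * dθ (dθ (Dz^[k] Ψ)) R θ) + Real.sin (2 * θ) * dθ (dθ (Dz^[k] f)) R θ +
          α ^ 2 * (Real.sin (2 * θ) * dθ (dθ (Dz^[k + 2] Ψ)) R θ - Real.sin (2 * θ) * dθ (dθ (Dz^[k + 1] Ψ)) R θ) +
          α * (5 + α) * (Real.sin (2 * θ) * dθ (dθ (Dz^[k + 1] Ψ)) R θ)))
    (fun p hp => h.sin3_dθ4_iterate_eq k hp)]
  have cV : ∀ j, ContinuousOn (uncurry (Dz^[j] Ψ)) strip := fun j => h.continuousOn_iterate_dθ j 0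
  have cdV : ∀ j, ContinuousOn (uncurry (dθ (Dz^[j] Ψ))) strip := fun j => h.continuousOn_iterate_dθ j 1
  have cddV : ∀ j, ContinuousOn (uncurry (dθ (dθ (Dz^[j] Ψ)))) strip := fun j => h.continuousOn_iterate_dθ j 2
  have cd3V : ∀ j, ContinuousOn (uncurry (dθ^[3] (Dz^[j] Ψ))) strip := fun j => h.continuousOn_iterate_dθ j 3
  have ctV : ∀ j, ContinuousOn (uncurry fun R θ => Real.tan θ * (Dz^[j] Ψ) R θ) strip := fun j => h.continuousOn_tan_mul' (cV j)
  have csd : ∀ j, ContinuousOn (uncurry fun R θ => Real.sin (2 * θ) * dθ (dθ (Dz^[j] Ψ)) R θ) strip := fun j => coef_sin_two.1.mul (cddV j)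
  have hsd : ∀ j, MemW (fun R θ => Real.sin (2 * θ) * dθ (dθ (Dz^[j] Ψ)) R θ) := fun j => h.memW_sin_dθ2 hV hdV htV hfpos j
  have cs3 : ContinuousOn (uncurry fun R θ => Real.sin (2 * θ) ^ 2 * (dθ^[3] (Dz^[k] Ψ)) R θ) strip := h.coef_sin_two_sq.1.mul (cd3V k)
  have hs3 : MemW (fun R θ => Real.sin (2 * θ) ^ 2 * (dθ^[3] (Dz^[k] Ψ)) R θ) := h.memW_sin2_dθ3 hV hdV htV hfpos k
  have hd2 : MemW (dθ (dθ (Dz^[k] f))) := h.memW_datum hfpos k 2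
  have cd2 : ContinuousOn (uncurry (dθ (dθ (Dz^[k] f)))) strip := (contDiffOn_dθ_strip (contDiffOn_dθ_strip (h.smooth_datum_iterate k))).continuousOn
  have hsd2 : MemW (fun R θ => Real.sin (2 * θ) * dθ (dθ (Dz^[k] f)) R θ) := hd2.coef_mul cd2 coef_sin_two.1 coef_sin_two.2
  have csd2 : ContinuousOn (uncurry fun R θ => Real.sin (2 * θ) * dθ (dθ (Dz^[k] f)) R θ) strip := coef_sin_two.1.mul cd2
  -- terms
  have t1 := (hsd k).coef_mul (csd k) h.coef_twelve_sin_sq.1 h.coef_twelve_sin_sq.2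
  have c1 : ContinuousOn (uncurry fun R θ => (12 * Real.sin θ ^ 2) * (Real.sin (2 * θ) * dθ (dθ (Dz^[k] Ψ)) R θ)) strip := h.coef_twelve_sin_sq.1.mul (csd k)
  have t2 := (hdV k).coef_mul (cdV k) h.coef_sin_four.1 h.coef_sin_four.2
  have c2 : ContinuousOn (uncurry fun R θ => (48 * Real.sin θ ^ 4) * dθ (Dz^[k] Ψ) R θ) strip := h.coef_sin_four.1.mul (cdV k)
  have t3 := hs3.coef_mul cs3 coef_two_sin_sq.1 coef_two_sin_sq.2
  have c3 : ContinuousOn (uncurry fun R θ => (2 * Real.sin θ ^ 2) * (Real.sin (2 * θ) ^ 2 * (dθ^[3] (Dz^[k] Ψ)) R θ)) strip := coef_two_sin_sq.1.mul cs3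
  have t4 := (htV k).coef_mul (ctV k) h.coef_mixed.1 h.coef_mixed.2
  have c4 : ContinuousOn (uncurry fun R θ => (16 * (Real.cos θ ^ 2 + 3 * Real.sin θ ^ 2) * Real.sin θ ^ 2) * (Real.tan θ * (Dz^[k] Ψ) R θ)) strip := h.coef_mixed.1.mul (ctV k)
  have t5in : MemW (fun R θ => 6 * (Real.sin (2 * θ) * dθ (dθ (Dz^[k] Ψ)) R θ) + Real.sin (2 * θ) * dθ (dθ (Dz^[k] f)) R θ +
      α ^ 2 * (Real.sin (2 * θ) * dθ (dθ (Dz^[k + 2] Ψ)) R θ - Real.sin (2 * θ) * dθ (dθ (Dz^[k + 1] Ψ)) R θ) +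
      α * (5 + α) * (Real.sin (2 * θ) * dθ (dθ (Dz^[k + 1] Ψ)) R θ)) := by
    have a1 := (((hsd k).const_mul 6).add hsd2 (continuousOn_const.mul (csd k) |>.congr fun p _ => rfl) csd2)
    have c1' : ContinuousOn (uncurry fun R θ => 6 * (Real.sin (2 * θ) * dθ (dθ (Dz^[k] Ψ)) R θ) + Real.sin (2 * θ) * dθ (dθ (Dz^[k] f)) R θ) strip :=
      (continuousOn_const.mul (csd k)).add csd2
    have a2 := ((hsd (k + 2)).sub (hsd (k + 1)) (csd (k + 2)) (csd (k + 1))).const_mul (α ^ 2)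
    have c2' : ContinuousOn (uncurry fun R θ => α ^ 2 * (Real.sin (2 * θ) * dθ (dθ (Dz^[k + 2] Ψ)) R θ - Real.sin (2 * θ) * dθ (dθ (Dz^[k + 1] Ψ)) R θ)) strip :=
      continuousOn_const.mul ((csd (k + 2)).sub (csd (k + 1)))
    have a3 := (hsd (k + 1)).const_mul (α * (5 + α))
    have c3' : ContinuousOn (uncurry fun R θ => α * (5 + α) * (Real.sin (2 * θ) * dθ (dθ (Dz^[k + 1] Ψ)) R θ)) strip := continuousOn_const.mul (csd (k + 1))
    exact (a1.add a2 c1' c2').add a3 (c1'.add c2') c3'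
  have c5in : ContinuousOn (uncurry fun R θ => 6 * (Real.sin (2 * θ) * dθ (dθ (Dz^[k] Ψ)) R θ) + Real.sin (2 * θ) * dθ (dθ (Dz^[k] f)) R θ +
      α ^ 2 * (Real.sin (2 * θ) * dθ (dθ (Dz^[k + 2] Ψ)) R θ - Real.sin (2 * θ) * dθ (dθ (Dz^[k + 1] Ψ)) R θ) +
      α * (5 + α) * (Real.sin (2 * θ) * dθ (dθ (Dz^[k + 1] Ψ)) R θ)) strip :=
    (((continuousOn_const.mul (csd k)).add csd2).add (continuousOn_const.mul ((csd (k + 2)).sub (csd (k + 1))))).add (continuousOn_const.mul (csd (k + 1)))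
  have t5 := t5in.coef_mul c5in h.coef_sin_two_sq.1 h.coef_sin_two_sq.2
  have c5 : ContinuousOn (uncurry fun R θ => Real.sin (2 * θ) ^ 2 * (6 * (Real.sin (2 * θ) * dθ (dθ (Dz^[k] Ψ)) R θ) + Real.sin (2 * θ) * dθ (dθ (Dz^[k] f)) R θ +
      α ^ 2 * (Real.sin (2 * θ) * dθ (dθ (Dz^[k + 2] Ψ)) R θ - Real.sin (2 * θ) * dθ (dθ (Dz^[k + 1] Ψ)) R θ) +
      α * (5 + α) * (Real.sin (2 * θ) * dθ (dθ (Dz^[k + 1] Ψ)) R θ))) strip := h.coef_sin_two_sq.1.mul c5in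
  exact ((((t1.add t2 c1 c2).add t3 (c1.add c2) c3).add t4 ((c1.add c2).add c3) c4).sub t5 (((c1.add c2).add c3).add c4) c5)

end TangentialFamily

end Elgindi

end Literature.Analysis.FluidPDE
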